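import Literature.Geometry.Kaehler.ComplexTorusWeilHodgeCyclesHodgeGroup
import HarnessLib

/-!
# The action of `K^× ⊂ End_ℚ(X)` on the Weil classes: `ρ(f) = f^r` on `W_K` (Moonen–Zarhin 1998, (2))

Layer `Literature/Geometry/Kaehler`, namespace `Literature.Geometry.Kaehler.ComplexTorus` (torus level) and
`Literature.Analysis.Complex` (general slot-eigen forms); lane `lit-hodgefound` (Track 2 foundations library),
Layer A4, self-proposed row «A4-40⁺ · Q340⁺ · (#3)⁺ — Moonen–Zarhin 1998 (2): "the multiplicative group
`F^*` acts on … `W_F ⊆ H^r(X, ℚ)` … `ρ(f)(w) = f^r · w`"» of `run/shared/lean/pub/lit-hodgefound/SKELETON.md`.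
Sequel of `ComplexTorusWeilTypeHodgeCycles.lean` (A4-40: `W_K = weilHodgeCycles Φ α d n`, the lines
`⋀^{2n} U_± = slotEigenForms (ρ α) (±√-d) (2n)`), `ComplexTorusWeilHodgeCyclesIsogeny.lean` (Q340 FILE 2:
`compContinuousLinearMap_mem_weilHodgeCycles` — a rational `P` commuting with `α` preserves `W_K`) and
`ComplexTorusWeilHodgeCyclesHodgeGroup.lean` (row #3). CONCRETE torus level, model-free: `X = E/Φ(ℤ^ι)`,
`K = ℚ(α) ⊂ End_ℚ(X)`, `α² = -d`; an element `f = q + p α ∈ K` (`q, p ∈ ℚ`) acts on `H^k(X, ℂ) = Alt^k_ℝ(E; ℂ)`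
by pull-back along `ρ(f) = q + p ρ(α)` (`analyticRepReal`); its two complex embeddings are
`σ(f) = q + p√-d`, `σ̄(f) = q - p√-d`.

## Source, verbatim

B. J. J. Moonen, Yu. G. Zarhin, *Weil classes on abelian varieties*, J. reine angew. Math. 496 (1998),
held `paper:arxiv-alg-geom_9612017`, paragraph (2) of the arXiv numbering (p. 1, L57–L66): "The
multiplicative group `F^*` acts on `⊕_i H^i(X, ℚ) ⊃ B•(X) ⊇ D•(X)` and on the subspace `W_F ⊆ H^r(X, ℚ)`. If
the latter action is given by `ρ : F^* → Gl(W_F)` then its relation to the natural structure of `F`-vector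
space on `W_F` is given by `ρ(f)(w) = f^r · w` for all `f ∈ F^*`, `w ∈ W`. Since `dim_F(W_F) = 1`, it
readily follows that either all elements of `W_F` are Hodge classes, or `0 ∈ W_F` is the only Hodge class".

## Rendering (theorems only; no definition, no named fact, net debt 0)

The "natural structure of `F`-vector space on `W_F`" is read after `⊗_ℚ ℂ`: `W_K ⊗ ℂ = ⋀^{2n} U₊ ⊕ ⋀^{2n} U₋`
(row #3 `span_complex_weilHodgeCycles_of_sq`), the `σ`- and `σ̄`-eigenlines of `K`, on which "`f^r ·`"
(`r = 2n`) is multiplication by `σ(f)^{2n}`, resp. `σ̄(f)^{2n}`.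
* §1 (general, any real operator `T`, any `c`): **`compContinuousLinearMap_eq_pow_smul_of_mem_slotEigenForms`**
  — if `T` acts by `c` in every slot of the `k`-form `γ` then `T^* γ = c^k · γ` (slot by slot);
  `mem_slotEigenForms_add_smul` — then `a + bT` acts by `a + bc` in every slot.
* §2 (torus): `analyticRepReal_fieldElt` (`ρ(q + pα) = q + p ρ(α)`),
  **`compContinuousLinearMap_fieldElt_of_mem_slotEigenForms_pos` / `_neg`** (`ρ(f)^* γ = σ(f)^k γ` on
  `⋀^k U₊`, `= σ̄(f)^k γ` on `⋀^k U₋` — "`ρ(f)(w) = f^r · w`"), **`fieldElt_compContinuousLinearMap_mem_weilHodgeCycles`**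
  (`K^×`, indeed `K`, preserves `W_K ⊆ H^{2n}(X, ℚ)`), and `compContinuousLinearMap_fieldElt_of_mem_span_weilHodgeCycles`
  (on `W_K ⊗ ℂ`: `ρ(f)^* (w₊ + w₋) = σ(f)^{2n} w₊ + σ̄(f)^{2n} w₋`).
The dichotomy "all of `W_F` Hodge, or only `0`" is row #3's `weilHodgeCycles_le_hodgeClasses_or_inf_eq_bot`
(proved there through Deligne's Prop. 4.4 / A4-40), not re-proved here.

NOT here: the `F^*`-stability of `B•(X)` and `D•(X)` (pull-back by NON-integral rational endomorphisms on
Hodge classes); CM fields `F ≠` imaginary quadratic.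

## References

* [MoonenZarhin1998WeilClasses] B. J. J. Moonen, Yu. G. Zarhin, *Weil classes on abelian varieties*,
  J. reine angew. Math. 496 (1998), (2) (arXiv alg-geom/9612017 p. 1).
* [vanGeemen1994HodgeAV] B. van Geemen, *An introduction to the Hodge conjecture for abelian varieties*,
  LNM 1594 (1994), 4.8–4.9 (`K` acts on `H^•(X, ℚ)` via `f^*`; the eigenspaces `W'_±`).
-/

noncomputable section

open scoped ComplexConjugate
open Complex Function Module Matrix
open Literature.Analysis.Complex Literature.Analysis.Complex.WeilOperator

/-! ## §1 A slot-eigen operator acts on the whole form by `c^k` -/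

namespace Literature.Analysis.Complex

variable {E : Type*} [NormedAddCommGroup E] [NormedSpace ℂ E]

/-- **`T^* γ = c^k · γ` for `γ ∈ ⋀^k U_c(T)`**: if the real operator `T` acts by `c` in every slot of `γ`,
then `γ(Tv₀, …, Tv_{k-1}) = c^k γ(v₀, …, v_{k-1})` (replace the slots one at a time). For `T = f^*`,
`f ∈ K ⊂ End(X)_ℚ`, this is "`ρ(f)(w) = f^r · w`" on the `σ`-eigenline.
[cite: MoonenZarhin1998WeilClasses, (2)] [cite: vanGeemen1994HodgeAV, 4.8–4.9] -/
theorem compContinuousLinearMap_eq_pow_smul_of_mem_slotEigenForms {T : E →L[ℝ] E} {c : ℂ} {k : ℕ}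
    {γ : E [⋀^Fin k]→L[ℝ] ℂ} (hγ : γ ∈ slotEigenForms T c k) :
    γ.compContinuousLinearMap T = c ^ k • γ := by
  classical
  ext v
  rw [ContinuousAlternatingMap.compContinuousLinearMap_apply, ContinuousAlternatingMap.smul_apply, smul_eq_mul]
  -- `w A`: the tuple with `T v i` on the slots of `A` and `v i` elsewhere
  set w : Finset (Fin k) → (Fin k → E) := fun A i ↦ if i ∈ A then T (v i) else v i with hw
  have key : ∀ A : Finset (Fin k), γ (w A) = c ^ A.card * γ (w ∅) := by
    intro A
    induction A using Finset.induction_on with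
    | empty => simp
    | insert a A ha ih =>
      have hupd : w (insert a A) = update (w A) a (T (w A a)) := by
        funext i
        by_cases hia : i = a
        · subst hia; simp [hw, ha]
        · rw [update_of_ne hia]
          simp [hw, Finset.mem_insert, hia]
      rw [hupd, hγ (w A) a, ih, Finset.card_insert_of_notMem ha, pow_succ]
      ring
  have h1 : (⇑T ∘ v) = w Finset.univ := by funext i; simp [hw]
  have h2 : v = w ∅ := by funext i; simp [hw]
  rw [h1, key, Finset.card_univ, Fintype.card_fin, ← h2]

/-- If `T` acts by `c` in every slot of `γ`, then `a + bT` acts by `a + bc` in every slot of `γ`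
(`a, b ∈ ℝ`). [cite: MoonenZarhin1998WeilClasses, (2)] -/
theorem mem_slotEigenForms_add_smul {T : E →L[ℝ] E} {c : ℂ} {k : ℕ} {γ : E [⋀^Fin k]→L[ℝ] ℂ}
    (hγ : γ ∈ slotEigenForms T c k) (a b : ℝ) :
    γ ∈ slotEigenForms (a • ContinuousLinearMap.id ℝ E + b • T) ((a : ℂ) + b * c) k := by
  rw [mem_slotEigenForms_iff] at hγ ⊢
  intro v i
  rw [_root_.add_apply, _root_.smul_apply, _root_.smul_apply, ContinuousLinearMap.id_apply, γ.map_update_add, γ.map_update_smul, γ.map_update_smul, update_eq_self, hγ,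
    Complex.real_smul, Complex.real_smul]
  ring

end Literature.Analysis.Complex

/-! ## §2 `K = ℚ(α)` acting on `H^k(X, ℂ)` and on the Weil classes -/

namespace Literature.Geometry.Kaehler

namespace ComplexTorus

variable {ι : Type*} [Fintype ι] [DecidableEq ι] {E : Type*} [NormedAddCommGroup E] [NormedSpace ℂ E]
  (Φ : (ι → ℝ) ≃L[ℝ] E) {α : Matrix ι ι ℚ} {d n : ℕ}

/-- **`ρ(q + pα) = q + p ρ(α)`** on `V_ℝ = E` (the real analytic representation is `ℚ`-linear and unital).
[cite: vanGeemen1994HodgeAV, 4.8 (`End(X)_ℚ` acts on `H^•(X, ℚ)`)] -/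
theorem analyticRepReal_fieldElt (α : Matrix ι ι ℚ) (q p : ℚ) :
    analyticRepReal Φ Φ ((q • (1 : Matrix ι ι ℚ) + p • α).map (Rat.cast : ℚ → ℝ)) =
      ((q : ℝ)) • ContinuousLinearMap.id ℝ E + ((p : ℝ)) • analyticRepReal Φ Φ (α.map (Rat.cast : ℚ → ℝ)) := by
  have hmap : (q • (1 : Matrix ι ι ℚ) + p • α).map (Rat.cast : ℚ → ℝ) =
      (q : ℝ) • (1 : Matrix ι ι ℝ) + (p : ℝ) • α.map (Rat.cast : ℚ → ℝ) := by
    ext i j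
    simp [Matrix.one_apply, apply_ite (Rat.cast : ℚ → ℝ)]
  rw [hmap, analyticRepReal_add, analyticRepReal_smul, analyticRepReal_smul, analyticRepReal_one]

/-- `f = q + pα ∈ K` commutes with `α`. [cite: vanGeemen1994HodgeAV, 4.9] -/
theorem mul_fieldElt_comm (α : Matrix ι ι ℚ) (q p : ℚ) :
    α * (q • (1 : Matrix ι ι ℚ) + p • α) = (q • (1 : Matrix ι ι ℚ) + p • α) * α := by
  rw [Matrix.mul_add, Matrix.add_mul, Matrix.mul_smul, Matrix.smul_mul, Matrix.mul_one, Matrix.one_mul,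
    Matrix.mul_smul, Matrix.smul_mul]

variable {Φ}

/-- **"`ρ(f)(w) = f^r · w`" on the `σ`-line: `ρ(f)^* γ = σ(f)^k · γ` for `γ ∈ ⋀^k U₊`**, `f = q + pα ∈ K`,
`σ(f) = q + p√-d`. [cite: MoonenZarhin1998WeilClasses, (2)] -/
theorem compContinuousLinearMap_fieldElt_of_mem_slotEigenForms_pos (q p : ℚ) {k : ℕ}
    {γ : E [⋀^Fin k]→L[ℝ] ℂ}
    (hγ : γ ∈ slotEigenForms (analyticRepReal Φ Φ (α.map (Rat.cast : ℚ → ℝ))) (sqrtNeg d) k) :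
    γ.compContinuousLinearMap (analyticRepReal Φ Φ ((q • (1 : Matrix ι ι ℚ) + p • α).map (Rat.cast : ℚ → ℝ))) =
      ((q : ℂ) + (p : ℂ) * sqrtNeg d) ^ k • γ := by
  rw [analyticRepReal_fieldElt]
  have h := compContinuousLinearMap_eq_pow_smul_of_mem_slotEigenForms (mem_slotEigenForms_add_smul hγ (q : ℝ) (p : ℝ))
  rw [h, Complex.ofReal_ratCast, Complex.ofReal_ratCast]

/-- **"`ρ(f)(w) = f^r · w`" on the `σ̄`-line: `ρ(f)^* γ = σ̄(f)^k · γ` for `γ ∈ ⋀^k U₋`**, `σ̄(f) = q - p√-d`.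
[cite: MoonenZarhin1998WeilClasses, (2)] -/
theorem compContinuousLinearMap_fieldElt_of_mem_slotEigenForms_neg (q p : ℚ) {k : ℕ}
    {γ : E [⋀^Fin k]→L[ℝ] ℂ}
    (hγ : γ ∈ slotEigenForms (analyticRepReal Φ Φ (α.map (Rat.cast : ℚ → ℝ))) (-sqrtNeg d) k) :
    γ.compContinuousLinearMap (analyticRepReal Φ Φ ((q • (1 : Matrix ι ι ℚ) + p • α).map (Rat.cast : ℚ → ℝ))) =
      ((q : ℂ) - (p : ℂ) * sqrtNeg d) ^ k • γ := by
  rw [analyticRepReal_fieldElt]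
  have h := compContinuousLinearMap_eq_pow_smul_of_mem_slotEigenForms (mem_slotEigenForms_add_smul hγ (q : ℝ) (p : ℝ))
  rw [h, Complex.ofReal_ratCast, Complex.ofReal_ratCast, mul_neg, ← sub_eq_add_neg]

/-- **`K^× ⊂ End_ℚ(X)^×` acts on `W_K`**: the pull-back along `ρ(f)`, `f = q + pα ∈ K`, maps the Weil classes
`W_K ⊆ H^{2n}(X, ℚ)` into themselves (`f` is rational and commutes with `α`).
[cite: MoonenZarhin1998WeilClasses, (2) ("`F^*` acts … on the subspace `W_F ⊆ H^r(X, ℚ)`")] -/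
theorem fieldElt_compContinuousLinearMap_mem_weilHodgeCycles (q p : ℚ) {γ : E [⋀^Fin (2 * n)]→L[ℝ] ℂ}
    (hγ : γ ∈ weilHodgeCycles Φ α d n) :
    γ.compContinuousLinearMap (analyticRepReal Φ Φ ((q • (1 : Matrix ι ι ℚ) + p • α).map (Rat.cast : ℚ → ℝ))) ∈
      weilHodgeCycles Φ α d n :=
  compContinuousLinearMap_mem_weilHodgeCycles (mul_fieldElt_comm α q p) hγ

omit [Fintype ι] [DecidableEq ι] in
/-- Pull-back is additive in the form. [folklore] -/
private theorem wfa_add_comp {k : ℕ} (γ δ : E [⋀^Fin k]→L[ℝ] ℂ) (f : E →L[ℝ] E) :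
    (γ + δ).compContinuousLinearMap f = γ.compContinuousLinearMap f + δ.compContinuousLinearMap f := by
  ext v; rfl

/-- **`ρ(f) = f^r` on `W_K ⊗ ℂ = ⋀^{2n} U₊ ⊕ ⋀^{2n} U₋`**: for `w = w₊ + w₋` in the plane,
`ρ(f)^* w = σ(f)^{2n} w₊ + σ̄(f)^{2n} w₋` — multiplication by `f^{2n} ⊗ 1 ∈ K ⊗_ℚ ℂ = ℂ_σ × ℂ_σ̄`.
[cite: MoonenZarhin1998WeilClasses, (2) ("`ρ(f)(w) = f^r · w`")] -/
theorem compContinuousLinearMap_fieldElt_of_add (q p : ℚ) {k : ℕ} {γp γm : E [⋀^Fin k]→L[ℝ] ℂ}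
    (hp : γp ∈ slotEigenForms (analyticRepReal Φ Φ (α.map (Rat.cast : ℚ → ℝ))) (sqrtNeg d) k)
    (hm : γm ∈ slotEigenForms (analyticRepReal Φ Φ (α.map (Rat.cast : ℚ → ℝ))) (-sqrtNeg d) k) :
    (γp + γm).compContinuousLinearMap (analyticRepReal Φ Φ ((q • (1 : Matrix ι ι ℚ) + p • α).map (Rat.cast : ℚ → ℝ))) =
      ((q : ℂ) + (p : ℂ) * sqrtNeg d) ^ k • γp + ((q : ℂ) - (p : ℂ) * sqrtNeg d) ^ k • γm := by
  rw [wfa_add_comp, compContinuousLinearMap_fieldElt_of_mem_slotEigenForms_pos q p hp,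
    compContinuousLinearMap_fieldElt_of_mem_slotEigenForms_neg q p hm]

/-- **Every Weil class decomposes as `w = w₊ + w₋` with `ρ(f)^* w = σ(f)^{2n} w₊ + σ̄(f)^{2n} w₋` for all
`f = q + pα ∈ K`** (`K = ℚ(α)`, `α² = -d < 0`, `dim X = 2n ≥ 1`; the components lie in the eigenlines
`⋀^{2n} U_±` spanned over `ℂ` by `W_K`, row #3). [cite: MoonenZarhin1998WeilClasses, (2)] -/
theorem exists_add_eq_of_mem_weilHodgeCycles {γ : E [⋀^Fin (2 * n)]→L[ℝ] ℂ} (hγ : γ ∈ weilHodgeCycles Φ α d n) :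
    ∃ γp ∈ slotEigenForms (analyticRepReal Φ Φ (α.map (Rat.cast : ℚ → ℝ))) (sqrtNeg d) (2 * n),
      ∃ γm ∈ slotEigenForms (analyticRepReal Φ Φ (α.map (Rat.cast : ℚ → ℝ))) (-sqrtNeg d) (2 * n),
        γp + γm = γ ∧ ∀ q p : ℚ,
          γ.compContinuousLinearMap
              (analyticRepReal Φ Φ ((q • (1 : Matrix ι ι ℚ) + p • α).map (Rat.cast : ℚ → ℝ))) =
            ((q : ℂ) + (p : ℂ) * sqrtNeg d) ^ (2 * n) • γp + ((q : ℂ) - (p : ℂ) * sqrtNeg d) ^ (2 * n) • γm := by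
  obtain ⟨γp, hp, γm, hm, hsum⟩ := Submodule.mem_sup.1 ((mem_weilHodgeCycles_iff Φ).1 hγ).2
  refine ⟨γp, hp, γm, hm, hsum, fun q p ↦ ?_⟩
  rw [← hsum]
  exact compContinuousLinearMap_fieldElt_of_add q p hp hm

end ComplexTorus

end Literature.Geometry.Kaehler
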